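import Summits.AtomisticToContinuum.Crystallization.Theses.PalmUnimodularRigidity
import Summits.AtomisticToContinuum.Crystallization.Theorems.MinimiserShells.Negative.LoadBearing
import Summits.AtomisticToContinuum.Crystallization.Theorems.MinimiserShells.Negative.Rootedness
import Summits.AtomisticToContinuum.Crystallization.Theorems.PalmUnimodularRigidityMinimiserShellsEquilibriumInLawCluster
import Summits.AtomisticToContinuum.Crystallization.Theorems.PalmUnimodularRigidityMinimiserShellsDeepBadPricingOfShellNoBoundary
import Summits.AtomisticToContinuum.Crystallization.Theorems.PalmUnimodularRigidityMinimiserShellsMuGSCBasics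
import Summits.AtomisticToContinuum.Crystallization.Theorems.PalmUnimodularRigidityMinimiserShellsSepReductionSeparated
import Summits.AtomisticToContinuum.Crystallization.Theorems.PalmUnimodularRigidityMinimiserShellsSepReductionBad

/-!
# The hard-core reduction of the qualitative no-boundary shell gap (stub S15e, reshape r6)

Stub `stub_qualShellNoBoundary_of_sepQualShellNoBoundary` (S15e, the assembly of the hard-core
reduction) of line `equilibrium-in-law-surgery` (reshape r6) of crux `MinimiserShells`
(stmt-AtomisticToContinuum-9225, route `PalmUnimodularRigidity`).

If the qualitative particle-level no-boundary shell gap holds for `1/3`-SEPARATED finite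
configurations — for every threshold `t > 0` some `κ > 0` such that every finite injective
`1/3`-separated `y : Fin N → ℝ³` with at least `t · N` badly-shelled sites has
`N · (e* + κ) ≤ 𝓔_N(y)` — then it holds for ALL finite injective configurations.

Proof.  Given `t`, take `κₛ` from the hypothesis at threshold `t/2` and set
`κ = min (κₛ/2) (min (t·|e*|/1234) (|e*|/2))` (`e* < 0`, `eStar_neg`).  Let `y` be injective with
`≥ t·N` badly-shelled sites and suppose `𝓔_N(y) < N·(e* + κ)`.  Let `C = range y` (`#C = N`,
`½ΣΣ_C V_LJ = 𝓔_N(y)`, `two_mul_interactionEnergy_eq_sum_sum_image`), and let `Z ⊆ C` minimise the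
half double sum `½ΣΣ V_LJ` over all sub-configurations of `C` (`exists_subset_sum_sum_le`).  Then

* `Z` is `1/3`-separated, being removal-minimal (`SepReduction.stub_sepReduction_separated`, S15b);
* few points are removed: `#Z·e* ≤ ½ΣΣ_Z V ≤ ½ΣΣ_C V < N·(e* + κ)`
  (`card_mul_eStar_le_half_sum_sum`) gives `(N − #Z)·|e*| < N·κ`, whence `N − #Z ≤ t·N/1234` and
  `#Z > N/2`;
* half of the bad shells survive: the badly-shelled indices of `y` are badly-shelled sites of `C`
  (`natCard_bad_le_natCard_bad_of_range_eq`), at most `616·(N − #Z)` of them are lost in `Z`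
  (`SepReductionBad.stub_sepReduction_bad`, S15d), and the badly-shelled sites of `Z` are
  badly-shelled indices of its canonical enumeration (`natCard_bad_le_natCard_bad_equivFin`), so the
  enumeration of `Z` has `≥ t·N − 616·(N − #Z) ≥ t·N/2 ≥ (t/2)·#Z` badly-shelled indices;
* the hypothesis applied to the (injective, `1/3`-separated) enumeration of `Z`
  (`two_mul_interactionEnergy_equivFin`) yields `#Z·(e* + κₛ) ≤ ½ΣΣ_Z V < N·e* + N·κ ≤ #Z·e* + N·κₛ/2`,
  i.e. `#Z·κₛ < N·κₛ/2`, contradicting `#Z > N/2`.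
-/

noncomputable section

open MeasureTheory
open scoped ENNReal BigOperators Classical

namespace Summit.AtomisticToContinuum.Crystallization.Theorems.PalmUnimodularRigidityMinimiserShells.SepReductionAssembly

open Literature.MathematicalPhysics.StatisticalMechanics (lennardJones interactionEnergy)
open Summit.AtomisticToContinuum.Crystallization.Theorems.MinimiserShells.Negative.LoadBearing (eStar GoodShell)
open Summit.AtomisticToContinuum.Crystallization.Theorems.MinimiserShells.Negative.Rootedness (E3)
open Summit.AtomisticToContinuum.Crystallization.Theorems.PalmUnimodularRigidityMinimiserShells.EquilibriumInLaw.Cluster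
  (two_mul_interactionEnergy_eq_sum_sum_image card_image_of_injective coe_image_univ
    two_mul_interactionEnergy_equivFin card_mul_eStar_le_half_sum_sum)
open Summit.AtomisticToContinuum.Crystallization.Theorems.PalmUnimodularRigidityMinimiserShells.ShellNoBoundary
  (equivFin_symm_val_injective range_equivFin_symm_val card_le_natCard_bad)
open Summit.AtomisticToContinuum.Crystallization.Theorems.PalmUnimodularRigidityMinimiserShells.VolumeGrowth.Basics
  (eStar_neg)
open Summit.AtomisticToContinuum.Crystallization.Theorems.PalmUnimodularRigidityMinimiserShells.SepReduction
  (stub_sepReduction_separated)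
open Summit.AtomisticToContinuum.Crystallization.Theorems.PalmUnimodularRigidityMinimiserShells.SepReductionBad
  (stub_sepReduction_bad natCard_subtype_eq_card_filter)

/-! ## Energy-minimal sub-configurations

The energy of a finite configuration `S ⊆ ℝ³` is the half double sum
`(∑_{a ∈ S} ∑_{b ∈ S} V_LJ(|a − b|)) / 2` (the diagonal terms vanish, `V_LJ(0) = 0`). -/

/-- **Energy-minimal sub-configurations exist.**  Every finite configuration `C` has a
sub-configuration `Z ⊆ C` of least half double sum among all sub-configurations of `C`
(`Finset.exists_min_image` on the powerset; the empty set is a candidate). -/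
theorem exists_subset_sum_sum_le (C : Finset E3) :
    ∃ Z ⊆ C, ∀ Z' ⊆ C, (∑ a ∈ Z, ∑ b ∈ Z, lennardJones (dist a b)) / 2 ≤
      (∑ a ∈ Z', ∑ b ∈ Z', lennardJones (dist a b)) / 2 := by
  obtain ⟨Z, hZ, hmin⟩ := Finset.exists_min_image C.powerset
    (fun S : Finset E3 => (∑ a ∈ S, ∑ b ∈ S, lennardJones (dist a b)) / 2)
    ⟨∅, Finset.empty_mem_powerset C⟩
  exact ⟨Z, Finset.mem_powerset.1 hZ, fun Z' hZ' => hmin Z' (Finset.mem_powerset.2 hZ')⟩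

/-- The interaction energy of an injective family `y : Fin N → ℝ³` is the half double sum of its
image Finset (`two_mul_interactionEnergy_eq_sum_sum_image`). -/
theorem interactionEnergy_eq_half_sum_sum_image {N : ℕ} {y : Fin N → E3}
    (hy : Function.Injective y) :
    interactionEnergy lennardJones y =
      (∑ a ∈ Finset.univ.image y, ∑ b ∈ Finset.univ.image y, lennardJones (dist a b)) / 2 := by
  have h := two_mul_interactionEnergy_eq_sum_sum_image hy
  linarith

/-- The interaction energy of the canonical enumeration of a Finset `Z` is its half double sum
(`two_mul_interactionEnergy_equivFin`). -/
theorem interactionEnergy_equivFin_eq_half_sum_sum (Z : Finset E3) :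
    interactionEnergy lennardJones (fun i => ((Z.equivFin.symm i : Z) : E3)) =
      (∑ a ∈ Z, ∑ b ∈ Z, lennardJones (dist a b)) / 2 := by
  have h := two_mul_interactionEnergy_equivFin Z
  linarith

/-- A `δ`-separated Finset has a `δ`-separated canonical enumeration. -/
theorem le_dist_equivFin {Z : Finset E3} {δ : ℝ}
    (hZ : ∀ x ∈ Z, ∀ z ∈ Z, x ≠ z → δ ≤ dist x z) :
    ∀ i j : Fin Z.card, i ≠ j →
      δ ≤ dist ((Z.equivFin.symm i : Z) : E3) ((Z.equivFin.symm j : Z) : E3) :=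
  fun i j hij => hZ _ (Z.equivFin.symm i).2 _ (Z.equivFin.symm j).2 fun h =>
    hij (Z.equivFin.symm.injective (Subtype.val_injective h))

/-! ## Badly-shelled sites: index form versus Finset form -/

/-- **Badly-shelled indices inject into badly-shelled sites.**  If `y : Fin N → ℝ³` is injective
with range `↑C`, the indices `i` that are badly shelled in `y` (re-rooted at `y i`) number at most
the sites `x ∈ C` that are badly shelled in `C` (via `i ↦ y i`). -/
theorem natCard_bad_le_natCard_bad_of_range_eq {N : ℕ} {y : Fin N → E3}
    (hy : Function.Injective y) {C : Finset E3} (hC : (↑C : Set E3) = Set.range y) :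
    Nat.card {i : Fin N // ¬ GoodShell
        ((Measure.count : Measure E3).restrict ((fun z => z - y i) '' Set.range y))} ≤
      Nat.card {x : C // ¬ GoodShell ((Measure.count : Measure E3).restrict
        ((fun z => z - (x : E3)) '' (↑C : Set E3)))} := by
  have hmem : ∀ i : Fin N, y i ∈ C := fun i => by
    rw [← Finset.mem_coe, hC]
    exact Set.mem_range_self i
  refine Nat.card_le_card_of_injective
    (fun i => (⟨⟨y i.1, hmem i.1⟩, by rw [hC]; exact i.2⟩ : {x : C // ¬ GoodShell
      ((Measure.count : Measure E3).restrict ((fun z => z - (x : E3)) '' (↑C : Set E3)))})) ?_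
  intro i j h
  have h' : y i.1 = y j.1 := congrArg (fun x : {x : C // ¬ GoodShell
      ((Measure.count : Measure E3).restrict ((fun z => z - (x : E3)) '' (↑C : Set E3)))} =>
    ((x.1 : C) : E3)) h
  exact Subtype.ext (hy h')

/-- **Badly-shelled sites inject into badly-shelled indices of the canonical enumeration.**  The
sites `x ∈ Z` badly shelled in `Z` number at most the indices badly shelled in the canonical
enumeration `i ↦ Z.equivFin.symm i` of `Z` (`card_le_natCard_bad` with `S = C = Z`, `R₀ = 2`,
every site being trivially deep; `natCard_subtype_eq_card_filter`). -/
theorem natCard_bad_le_natCard_bad_equivFin (Z : Finset E3) :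
    Nat.card {x : Z // ¬ GoodShell ((Measure.count : Measure E3).restrict
        ((fun z => z - (x : E3)) '' (↑Z : Set E3)))} ≤
      Nat.card {i : Fin Z.card // ¬ GoodShell ((Measure.count : Measure E3).restrict
        ((fun z => z - ((Z.equivFin.symm i : Z) : E3)) ''
          Set.range (fun i => ((Z.equivFin.symm i : Z) : E3))))} := by
  have hZ : Nat.card {x : Z // ¬ GoodShell ((Measure.count : Measure E3).restrict
      ((fun z => z - (x : E3)) '' (↑Z : Set E3)))} =
      (Z.filter fun x => ¬ GoodShell ((Measure.count : Measure E3).restrict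
        ((fun z => z - x) '' (↑Z : Set E3)))).card :=
    natCard_subtype_eq_card_filter Z fun x => ¬ GoodShell ((Measure.count : Measure E3).restrict
      ((fun z => z - x) '' (↑Z : Set E3)))
  rw [hZ]
  exact card_le_natCard_bad (S := (↑Z : Set E3)) (C := Z) subset_rfl (by norm_num : (5 : ℝ) / 4 ≤ 2)
    (Finset.filter_subset _ Z) (fun x hx => ⟨(Finset.mem_filter.1 hx).2, Set.inter_subset_left⟩)
    (range_equivFin_symm_val Z)

/-! ## The reduction, Finset form -/

/-- **The hard-core reduction, Finset form.**  Let `t > 0`, `κₛ > 0` and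
`κ ≤ min (κₛ/2) (t·|e*|/1234) (|e*|/2)`, and assume the separated gap at threshold `t/2` with excess
`κₛ`.  Then every finite configuration `C` with at least `t · #C` badly-shelled sites has
`#C · (e* + κ) ≤ ½ΣΣ_C V_LJ`: otherwise an energy-minimal sub-configuration `Z ⊆ C`
(`exists_subset_sum_sum_le`) is `1/3`-separated (`stub_sepReduction_separated`), has
`#C − #Z ≤ t·#C/1234` and `#Z > #C/2` (`card_mul_eStar_le_half_sum_sum`, `e* < 0`), keeps
`≥ (t/2)·#Z` badly-shelled sites (`stub_sepReduction_bad`, `natCard_bad_le_natCard_bad_equivFin`),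
and the separated gap applied to its canonical enumeration gives `#Z·κₛ < #C·κₛ/2`, absurd. -/
theorem card_mul_le_half_sum_sum_of_sep {t κₛ κ : ℝ} (ht : 0 < t) (hκs : 0 < κₛ) (hκ1 : κ ≤ κₛ / 2)
    (hκ2 : κ ≤ t * (-eStar) / 1234) (hκ3 : κ ≤ (-eStar) / 2)
    (hgapₛ : ∀ (N : ℕ) (y : Fin N → E3), Function.Injective y →
      (∀ i j : Fin N, i ≠ j → (1 : ℝ) / 3 ≤ dist (y i) (y j)) →
      t / 2 * (N : ℝ) ≤ (Nat.card {i : Fin N // ¬ GoodShell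
          ((Measure.count : Measure E3).restrict ((fun z => z - y i) '' Set.range y))} : ℝ) →
      (N : ℝ) * (eStar + κₛ) ≤ interactionEnergy lennardJones y)
    (C : Finset E3)
    (hbadC : t * (C.card : ℝ) ≤ (Nat.card {x : C // ¬ GoodShell ((Measure.count : Measure E3).restrict
        ((fun z => z - (x : E3)) '' (↑C : Set E3)))} : ℝ)) :
    (C.card : ℝ) * (eStar + κ) ≤ (∑ a ∈ C, ∑ b ∈ C, lennardJones (dist a b)) / 2 := by
  by_contra hlt
  rw [not_le] at hlt
  have he : eStar < 0 := eStar_neg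
  -- the energy-minimal sub-configuration `Z ⊆ C`: removal-minimal, hence `1/3`-separated
  obtain ⟨Z, hZC, hZmin⟩ := exists_subset_sum_sum_le C
  have hZleC : (∑ a ∈ Z, ∑ b ∈ Z, lennardJones (dist a b)) / 2 ≤
      (∑ a ∈ C, ∑ b ∈ C, lennardJones (dist a b)) / 2 := hZmin C (Finset.Subset.refl C)
  have hsep : ∀ x ∈ Z, ∀ z ∈ Z, x ≠ z → (1 : ℝ) / 3 ≤ dist x z :=
    stub_sepReduction_separated Z fun x _ => hZmin (Z.erase x) ((Finset.erase_subset x Z).trans hZC)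
  -- few points are removed: `(#C - #Z)·|e*| < #C·κ`
  have hzcn : (Z.card : ℝ) ≤ C.card := by exact_mod_cast Finset.card_le_card hZC
  have hZE : (Z.card : ℝ) * eStar ≤ (∑ a ∈ Z, ∑ b ∈ Z, lennardJones (dist a b)) / 2 :=
    card_mul_eStar_le_half_sum_sum Z
  have hn : (0 : ℝ) ≤ C.card := Nat.cast_nonneg _
  have hnκ1 : (C.card : ℝ) * κ ≤ C.card * (κₛ / 2) := mul_le_mul_of_nonneg_left hκ1 hn
  have hnκ2 : (C.card : ℝ) * κ ≤ C.card * (t * (-eStar) / 1234) := mul_le_mul_of_nonneg_left hκ2 hn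
  have hnκ3 : (C.card : ℝ) * κ ≤ C.card * ((-eStar) / 2) := mul_le_mul_of_nonneg_left hκ3 hn
  have hm1 : ((C.card : ℝ) - Z.card) * (-eStar) ≤ t * C.card / 1234 * (-eStar) := by linarith
  have hm : (C.card : ℝ) - Z.card ≤ t * C.card / 1234 := le_of_mul_le_mul_right hm1 (neg_pos.2 he)
  have hm2 : ((C.card : ℝ) - Z.card) * (-eStar) < C.card / 2 * (-eStar) := by linarith
  have hhalf : (C.card : ℝ) - Z.card < C.card / 2 := lt_of_mul_lt_mul_right hm2 (neg_nonneg.2 he.le)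
  -- half of the bad shells survive in `Z`
  have hbadCZ : (Nat.card {x : C // ¬ GoodShell ((Measure.count : Measure E3).restrict
      ((fun z => z - (x : E3)) '' (↑C : Set E3)))} : ℝ) ≤
      (Nat.card {x : Z // ¬ GoodShell ((Measure.count : Measure E3).restrict
        ((fun z => z - (x : E3)) '' (↑Z : Set E3)))} : ℝ) + 616 * ((C.card : ℝ) - (Z.card : ℝ)) :=
    stub_sepReduction_bad C Z hZC hsep
  have hbadZz : (Nat.card {x : Z // ¬ GoodShell ((Measure.count : Measure E3).restrict
      ((fun z => z - (x : E3)) '' (↑Z : Set E3)))} : ℝ) ≤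
      (Nat.card {i : Fin Z.card // ¬ GoodShell ((Measure.count : Measure E3).restrict
        ((fun z => z - ((Z.equivFin.symm i : Z) : E3)) ''
          Set.range (fun i => ((Z.equivFin.symm i : Z) : E3))))} : ℝ) := by
    exact_mod_cast natCard_bad_le_natCard_bad_equivFin Z
  have htz : t / 2 * (Z.card : ℝ) ≤ t / 2 * C.card := mul_le_mul_of_nonneg_left hzcn (by linarith)
  have htn : 0 ≤ t * (C.card : ℝ) := mul_nonneg ht.le hn
  have hbadz : t / 2 * (Z.card : ℝ) ≤
      (Nat.card {i : Fin Z.card // ¬ GoodShell ((Measure.count : Measure E3).restrict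
        ((fun z => z - ((Z.equivFin.symm i : Z) : E3)) ''
          Set.range (fun i => ((Z.equivFin.symm i : Z) : E3))))} : ℝ) := by
    linarith
  -- the separated gap applied to the canonical enumeration of `Z`
  have hgapZ : (Z.card : ℝ) * (eStar + κₛ) ≤
      interactionEnergy lennardJones (fun i => ((Z.equivFin.symm i : Z) : E3)) :=
    hgapₛ Z.card (fun i => ((Z.equivFin.symm i : Z) : E3)) (equivFin_symm_val_injective Z)
      (le_dist_equivFin hsep) hbadz
  have hEz := interactionEnergy_equivFin_eq_half_sum_sum Z
  -- contradiction: `#Z·κₛ < #C·κₛ/2` against `#Z > #C/2`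
  have hne : (C.card : ℝ) * eStar ≤ Z.card * eStar := mul_le_mul_of_nonpos_right hzcn he.le
  have hck : (C.card : ℝ) / 2 * κₛ < Z.card * κₛ := mul_lt_mul_of_pos_right (by linarith) hκs
  linarith

/-! ## The stub -/

/-- **Stub `stub_qualShellNoBoundary_of_sepQualShellNoBoundary` (S15e) of line
`equilibrium-in-law-surgery` (reshape r6): the hard-core reduction.**  The qualitative particle-level
no-boundary shell gap for `1/3`-separated finite configurations implies the general one: given `t`,
take `κₛ` from the hypothesis at threshold `t/2` and `κ = min (κₛ/2) (min (t·|e*|/1234) (|e*|/2))`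
(`eStar_neg`); for an injective `y` with `≥ t·N` badly-shelled sites, its image Finset `C`
(`#C = N`, `½ΣΣ_C V = 𝓔_N(y)`: `card_image_of_injective`, `interactionEnergy_eq_half_sum_sum_image`)
has `≥ t·#C` badly-shelled sites (`natCard_bad_le_natCard_bad_of_range_eq`), so
`N·(e* + κ) ≤ 𝓔_N(y)` by the Finset form `card_mul_le_half_sum_sum_of_sep` (energy-minimal
sub-configuration: separated by S15b, few points lost by periodisation, half the bad shells kept by
S15d, then the separated gap on its enumeration). -/
theorem stub_qualShellNoBoundary_of_sepQualShellNoBoundary :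
    (∀ t : ℝ, 0 < t → ∃ κ : ℝ, 0 < κ ∧ ∀ (N : ℕ) (y : Fin N → EuclideanSpace ℝ (Fin 3)), Function.Injective y →
      (∀ i j : Fin N, i ≠ j → (1 : ℝ) / 3 ≤ dist (y i) (y j)) →
      t * (N : ℝ) ≤ (Nat.card {i : Fin N // ¬ GoodShell
          ((Measure.count : Measure (EuclideanSpace ℝ (Fin 3))).restrict ((fun z => z - y i) '' Set.range y))} : ℝ) →
      (N : ℝ) * (eStar + κ) ≤ interactionEnergy lennardJones y) →
    ∀ t : ℝ, 0 < t → ∃ κ : ℝ, 0 < κ ∧ ∀ (N : ℕ) (y : Fin N → EuclideanSpace ℝ (Fin 3)), Function.Injective y →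
      t * (N : ℝ) ≤ (Nat.card {i : Fin N // ¬ GoodShell
          ((Measure.count : Measure (EuclideanSpace ℝ (Fin 3))).restrict ((fun z => z - y i) '' Set.range y))} : ℝ) →
      (N : ℝ) * (eStar + κ) ≤ interactionEnergy lennardJones y := by
  intro hgap t ht
  obtain ⟨κₛ, hκs, hgapₛ⟩ := hgap (t / 2) (half_pos ht)
  have he : 0 < -eStar := neg_pos.2 eStar_neg
  refine ⟨min (κₛ / 2) (min (t * (-eStar) / 1234) ((-eStar) / 2)),
    lt_min (half_pos hκs) (lt_min (div_pos (mul_pos ht he) (by norm_num)) (half_pos he)), ?_⟩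
  intro N y hy hbad
  -- the image Finset `C` of `y` has `#C = N` and `≥ t·N` badly-shelled sites
  have hbadC : t * ((Finset.univ.image y).card : ℝ) ≤
      (Nat.card {x : (Finset.univ.image y) // ¬ GoodShell ((Measure.count : Measure E3).restrict
        ((fun z => z - (x : E3)) '' (↑(Finset.univ.image y) : Set E3)))} : ℝ) := by
    rw [card_image_of_injective hy]
    exact hbad.trans (by exact_mod_cast natCard_bad_le_natCard_bad_of_range_eq hy (coe_image_univ y))
  have key := card_mul_le_half_sum_sum_of_sep ht hκs (min_le_left _ _)
    ((min_le_right _ _).trans (min_le_left _ _)) ((min_le_right _ _).trans (min_le_right _ _))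
    hgapₛ (Finset.univ.image y) hbadC
  rw [card_image_of_injective hy] at key
  exact key.trans_eq (interactionEnergy_eq_half_sum_sum_image hy).symm

end Summit.AtomisticToContinuum.Crystallization.Theorems.PalmUnimodularRigidityMinimiserShells.SepReductionAssembly

end
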